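import Literature.AlgebraicGeometry.AbelianSchemes.AbelianSchemeKOfLConstantOfLevelCover
import Literature.AlgebraicGeometry.AbelianSchemes.LevelBasisCoverFreeQuotient
import Literature.AlgebraicGeometry.AbelianSchemes.AbelianSchemeRelDimOfConnected
import Literature.AlgebraicGeometry.AbelianSchemes.AbelianSchemeFiniteSubgroupTorsion
import Literature.AlgebraicGeometry.AbelianSchemes.AbelianSchemeBaseChangeActionOver
import Literature.AlgebraicGeometry.AbelianSchemes.AbelianSchemeKOfLSeesaw
import Literature.AlgebraicGeometry.AbelianSchemes.LevelStructureLocus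
import Literature.AlgebraicGeometry.AbelianSchemes.DualPairBaseQuotientDescent
import HarnessLib

/-!
# F-3 (M) child line, letter (Ma) `stub_F3Ma` — CLOSED: `K(L)` splits over a connected free finite base quotient

Cell `hodgecm-mathlib` (D-0151), FLOOR-0 programme P1, crux line `Cruxes/HDel/Lines/F3DualAbelianSchemeM.lean` (child of the
registered F-3 sub-line `Cruxes/HDel/Lines/F3DualAbelianScheme.lean`, stmt-HodgeConjecture-24835), letter (Ma) ed. 4 (B-typ04
(g15) 8047f009 :98; B-plan1 (g19) ruling r-conn 2026-08-30 19:36Z).  `stub_F3Ma_holds` below is the letter TOKEN FOR TOKEN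
(a Cruxes workfile is not importable, so the head is restated; the line file closes its `sorry` by `exact stub_F3Ma_holds`).
Assembler B-p19 (g18) ((Ma) lead B-p02 (g16) word 20:01Z).  HC_CM is proved only modulo the 7 printed citations until rung 0
closes; nothing here is about HC.

PROOF = composition of cell capital, all ★ or ★-in-HOME at assembly time:
* ★ `AbelianSchemeKOfLSeesaw.exists_one_mul_inv_fac_of_memKOfL` — the unit ∕ law ∕ inverse of `K(L)` factor through `Z`;
* (T3) `exists_pow_eq_one_of_formallyUnramified` (B-p08 (g15), `AbelianSchemeFiniteSubgroupTorsion`) — `i ^ M = 1`, `M ≥ 1`;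
* (G6) `exists_isOfRelDim` (B-p02 (g16), `AbelianSchemeRelDimOfConnected`) — a relative dimension `g` over the connected base;
* (Ma0-conn) `exists_connected_levelCover_free_geometricQuotient_of_algebra_rat` (B-p02 (g16), `LevelBasisCoverFreeQuotient`) —
  the CONNECTED affine finite étale surjective level-`M` cover `p : S′ → Spec R`, free `G`-quotient, level structure on `A ×_R S′`;
* (E7) `exists_actionOver_baseChange` (B-p13 (g21), `AbelianSchemeBaseChangeActionOver`) — `ρA = 1_A × ρ` and its two
  ★ `IsBaseChangeVia` clauses;
* brick 4 `exists_finite_subgroup_memKOfL_iff_baseChange` (B-p19 (g18), `AbelianSchemeKOfLConstantOfLevelCover`) — the finite,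
  fibrewise-free constant subgroup `K′ = K(L′)(S′)` with the membership clause.

## References
* [MumfordAV1970] D. Mumford, *Abelian Varieties* (1970), §13 (p. 123) and §7 Thm. 4 (p. 72).
* [MumfordFogartyKirwan1994] D. Mumford, J. Fogarty, F. Kirwan, *Geometric Invariant Theory*, 3rd ed. (1994), Ch. 7 §2
  Proposition 7.3, proof, step (IV) (pp. 133–134).
-/

noncomputable section

open CategoryTheory CategoryTheory.Limits AlgebraicGeometry MonoidalCategory CartesianMonoidalCategory

open scoped MonObj

open Literature.AlgebraicGeometry.AbelianSchemes Literature.AlgebraicGeometry.RelativeSpec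
  Literature.AlgebraicGeometry.Modules Literature.AlgebraicGeometry.Motives Literature.AlgebraicGeometry.AbelianVarieties

namespace Summit.HodgeConjecture.CorCM.HypDel.F3DualAbelianSchemeM

/-- `M` is invertible in the residue fields of a scheme over a `ℚ`-algebra. [cite: MumfordFogartyKirwan1994, Ch. 7 §2 Proposition 7.3, proof, step (IV) (pp. 133–134)] -/
private theorem natCast_residueField_ne_zero_of_algebraRat (R : Type) [CommRing R] [Algebra ℚ R] (M : ℕ) [NeZero M]
    {S' : Scheme.{0}} (p : S' ⟶ Spec (.of R)) (s : S') : (M : S'.residueField s) ≠ 0 := by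
  refine AbelianSchemeOver.natCast_residueField_ne_zero_of_hom p (fun t => ?_) s
  let φ : ℚ →+* (Spec (.of R)).residueField t :=
    (Spec.preimage ((Spec (.of R)).fromSpecResidueField t ≫ Spec.map (CommRingCat.ofHom (algebraMap ℚ R)))).hom
  rw [← map_natCast φ M]
  exact (map_ne_zero φ).mpr (Nat.cast_ne_zero.mpr (NeZero.ne M))

/-- **Letter (Ma) `stub_F3Ma` of the F-3 (M) child line (ed. 4), token for token — PROVED.**  Over a connected Noetherian
affine `ℚ`-base, for `L` of rank one rigidified along the unit section with ample geometric fibre classes and `K(L)`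
represented by a finite étale closed subgroup scheme: there is a connected affine finite étale surjective free finite base
quotient `p : S′ → Spec R` (the connected level-`M`-basis cover, `M` an exponent killing `K(L)`) with the base-change action on
`A ×_R S′` and its cartesian squares of group schemes, over which `K(L|_{A ×_R S′})` is the CONSTANT subgroup scheme on a finite
subgroup `K′` of sections, free on geometric fibres ([MumfordAV1970] §13: «`K(L)` … is a finite group», made étale-local as
in [MumfordFogartyKirwan1994] Ch. 7 §2 Prop. 7.3 step (IV)). [cite: MumfordAV1970, §13 (p. 123)]
[cite: MumfordFogartyKirwan1994, Ch. 7 §2 Proposition 7.3, proof, step (IV) (pp. 133–134)] -/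
theorem stub_F3Ma_holds : ∀ (R : Type) [CommRing R] [IsNoetherianRing R] [Algebra ℚ R] [ConnectedSpace ↥(Spec (.of R))]
    (A : AbelianSchemeOver (Spec (.of R)))
    (L : A.left.Modules) (hL : HasRank L 1)
    (_hε : CechPic.pullback A.unitSection (detClass (HasRank.isFiniteLocallyFree' hL)) = 1)
    (_hΘ : ∀ ⦃Ω : Type⦄ [Field Ω] [IsAlgClosed Ω] (s : Spec (.of Ω) ⟶ Spec (.of R)),
      ∃ Θ : CartierDivisor (A.fibre s).toAbelianVariety.X.left, Θ.IsAmple ∧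
        CechPic.pullback (X := (A.fibre s).toAbelianVariety.X.left) (pullback.fst A.X.hom s)
          (detClass (HasRank.isFiniteLocallyFree' hL)) = Θ.cechClass)
    (_hK : ∃ (Z : Over (Spec (.of R))) (i : Z ⟶ A.X) (_ : IsClosedImmersion i.left) (_ : IsFinite Z.hom) (_ : Etale Z.hom),
      ∀ (T : Over (Spec (.of R))) (u : T ⟶ A.X), (∃ v : T ⟶ Z, v ≫ i = u) ↔ A.MemKOfL L u),
    ∃ (S' : Scheme.{0}) (p : S' ⟶ Spec (.of R)) (_ : IsAffine S') (_ : IsLocallyNoetherian S') (_ : IsAffineHom p)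
      (_ : IsFinite p) (_ : LocallyOfFiniteType p) (_ : Etale p) (_ : Surjective p)
      (G : Type) (_ : Group G) (_ : Fintype G) (ρ : ActionOver p G)
      (ρA : ActionOver (pullback.fst A.X.hom p) G) (_ : (A.baseChange p).IsBaseChangeVia A p (pullback.fst A.X.hom p))
      (_ : ∀ γ₀ : G, (A.baseChange p).IsBaseChangeVia (A.baseChange p) (ρ.aut γ₀).hom (ρA.aut γ₀).hom),
      ρ.IsGeometricQuotient p ∧
      (∀ (V : (Spec (.of R)).Opens), IsAffineOpen V → ∀ γ₀ : G, γ₀ ≠ 1 →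
        Ideal.span (Set.range fun s : Γ(S', p ⁻¹ᵁ V) ↦ ρ.act γ₀ V s - s) = ⊤) ∧
      ∃ (K' : Subgroup (A.baseChange p).Sections) (_ : Finite K'),
        (∀ (Ω : Type) [Field Ω] [IsAlgClosed Ω] (s : Spec (.of Ω) ⟶ S') (σ : (A.baseChange p).Sections), σ ∈ K' → σ ≠ 1 →
          (A.baseChange p).restrict s σ ≠ (A.baseChange p).restrict s 1) ∧
        ∀ (T : Over S') (u : T ⟶ (A.baseChange p).X),
          (A.baseChange p).MemKOfL ((Scheme.Modules.pullback (pullback.fst A.X.hom p)).obj L) u ↔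
            ∃ 𝒱 : Scheme.OpenCover.{0} T.left, ∀ j, ∃ σ : K',
              𝒱.f j ≫ u.left = 𝒱.f j ≫ T.hom ≫ (σ : (A.baseChange p).Sections).left := by
  intro R _ _ _ _ A L hL hε _hΘ hK
  obtain ⟨Z, i, hci, hZfin, hZet, hZ⟩ := hK
  haveI := hci
  haveI := hZfin
  haveI := hZet
  -- (T3): an exponent `M ≥ 1` with `i ^ M = 1`
  obtain ⟨he, hm, hn⟩ := A.exists_one_mul_inv_fac_of_memKOfL i hL hε hZ
  obtain ⟨M, hMpos, hin⟩ := A.exists_pow_eq_one_of_formallyUnramified i he hm hn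
  haveI : NeZero M := ⟨hMpos.ne'⟩
  -- (G6) + (Ma0-conn): the connected level-`M` cover
  obtain ⟨g, hg⟩ := A.exists_isOfRelDim
  obtain ⟨S', p, hAff, hconn, hAffHom, hpfin, hpet, hpsurj, G, iG, fG, ρ, hq, hfree, ⟨φ⟩⟩ :=
    A.exists_connected_levelCover_free_geometricQuotient_of_algebra_rat R hg M
  haveI := hAff
  haveI := hconn
  haveI := hAffHom
  haveI := hpfin
  haveI := hpet
  haveI := hpsurj
  letI := iG
  letI := fG
  -- (E7): the base-change action and its squares
  obtain ⟨ρA, -, -, hAB, hsq⟩ := AbelianSchemeOver.exists_actionOver_baseChange ρ A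
  -- instances and the invertibility of `M` on `S′`
  haveI : IsLocallyNoetherian S' := LocallyOfFiniteType.isLocallyNoetherian p
  have hM : ∀ s : S', (M : S'.residueField s) ≠ 0 := natCast_residueField_ne_zero_of_algebraRat R M p
  -- brick 4: the `K′`-clause
  obtain ⟨K', hK'fin, hK'free, hK'iff⟩ := A.exists_finite_subgroup_memKOfL_iff_baseChange L hL hε i hZ hin p hM φ
  exact ⟨S', p, hAff, inferInstance, hAffHom, hpfin, inferInstance, hpet, hpsurj, G, iG, fG, ρ, ρA, hAB, hsq, hq, hfree,
    K', hK'fin, hK'free, hK'iff⟩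

end Summit.HodgeConjecture.CorCM.HypDel.F3DualAbelianSchemeM

end
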